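import Literature.AlgebraicGeometry.AbelianVarieties.MarkmanKernelDescent
import HarnessLib

/-!
# The class identity `π′^*[𝒩₀] = [𝒩] · g′^*[D′_s]` and the descent `π′^*𝒩₀ ≅ 𝒩 ⊗ g′^*D′_s` of Markman's twisted kernel

Layer `Literature/AlgebraicGeometry/AbelianVarieties`; sequel to `MarkmanKernelDescent` (the objects `Θ_sym`, `Θ̂`, `D′_s`,
`Z₀ = (A/G₁ × A/G₂) × Â`, `π′`, `κᵢ`, `𝒩₀` and their classes along `T`-valued points) and `MarkmanKernelTranslate` (`𝒩`, `g′`,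
the `λ`/`Λ` calculus). For `2j + 1 = n = |G₁| = |G₂|`, `n m₁ = 2s + j + 1`, `n m₂ + j = 2s`:

* `ofMul_pullback_quotientSpanProjection_detClass_markmanDescendedKernel`: the class of `π′^*𝒩₀` in monomials,
  `m₁·n·(λ(a)+λ(a⁻¹)) + m₂·n·(λ(b)+λ(b⁻¹)) + s·λ(β′) + (s+1)·λ(β′⁻¹) + m₁·n·Λ(a,β′) + m₂·n·Λ(b,β′)` (`β′ = β·φ_Θ⁻¹`), by
  `πᵢ^*[isogenyNorm πᵢ Θ_sym] = [Θ_sym]^n` (`IsogenyNormDescent`, `n` odd), `π′ ≫ κᵢ = (aᵢⁿ, β)` and `Λ(xⁿ, y) = n·Λ(x, y)`;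
* **`pullback_quotientSpanProjection_detClass_markmanDescendedKernel : π′^*[𝒩₀] = [𝒩] · g′^*[D′_s]`** — the right side expanded
  along `g′ = (ab⁻¹, β·φ_Θ(ab))` by biadditivity and `Λ(x, x) = λ(x) + λ(x⁻¹)`; the cross term `Λ(a, b)` vanishes exactly and
  the exponent arithmetic is `(2s+j+1)·X = n m₁·X`, `(2s−j)·X = n m₂·X`;
* **`nonempty_pullback_markmanDescendedKernel_iso : Nonempty (π′^*𝒩₀ ≅ 𝒩 ⊗ g′^*D′_s)`** (rank-one classification) and
  `exists_descent_exponents` (the exponents exist for every odd `n`).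

This is print's Remark 9.3.7 («`(𝒢 ⊗ D^a, λ ⊗ (∧^r λ)^a)` descends to an object on `Y`») read on the KERNEL of `Φ̃`: no
linearisation and no cocycle — two parity facts about `n` odd and the norm along the cyclic quotients. Cyclicity of `Gᵢ` and
`G₁ ∩ G₂ = 0` are not used. Everything PROVED; 0 named facts; no instance, no notation. A research route conditional on HC_CM,
not a corollary — nothing here refers to it.

## References

* E. Markman, arXiv:2502.03415 (2025), §9.3 Lemma 9.3.5, Remark 9.3.7 (pp. 71–73). [Markman2025SecantWeil]
* D. Mumford, *Abelian Varieties* (1970), §6 Cor. 3–4, §7 Thm. 4 (p. 72), §23. [MumfordAV1970]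
* R. Hartshorne, *Algebraic Geometry* (1977), II Ex. 6.11, III Ex. 4.5. [Hartshorne1977]
-/

noncomputable section

-- `TopCat.Presheaf`/`Scheme.Modules` are not reducible (as in Mathlib's `AlgebraicGeometry/Modules/Sheaf.lean`).
set_option backward.isDefEq.respectTransparency false

open CategoryTheory CategoryTheory.Limits AlgebraicGeometry MonoidalCategory CartesianMonoidalCategory
open AlgebraicGeometry.Scheme.Modules

namespace Literature.AlgebraicGeometry.AbelianVarieties

open Literature.AlgebraicGeometry.Motives Literature.AlgebraicGeometry.Modules
open scoped MonObj

variable (A : AbelianVariety ℂ) {Θ : CartierDivisor A.X.left} (hΘ : Θ.IsAmple)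

/-! ### §4 The class identity `π′^*[𝒩₀] = [𝒩] · g′^*[D′_s]` and the descent isomorphism -/

section Identity

variable (hK : A.KTheta Θ = ⊥) {n : ℕ} (hn : n ≠ 0) (G₁ G₂ : Subgroup (A.Points ℂ))
  (hG₁ : G₁ ≤ A.torsionPoints ℂ n) (hG₂ : G₂ ≤ A.torsionPoints ℂ n)

/-- `(f ≫ g)^* = f^* ∘ g^*` on `Ȟ¹(–, 𝒪^×)` (the tree's `CechPic.pullback_comp` of `Modules/UnitCocyclePresented`, outside this
file's imports; re-proved privately as in `PoincareSheafOfPrincipal`). [cite: Hartshorne1977, II Ex. 6.8 (functoriality of f^* on Pic)] -/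
private theorem cechPic_pullback_comp₄ {X Y Z : Scheme.{0}} (f : X ⟶ Y) (g : Y ⟶ Z) (c : CechPic Z) :
    CechPic.pullback (f ≫ g) c = CechPic.pullback f (CechPic.pullback g c) := by
  obtain ⟨c, rfl⟩ := CechPic.mk_surjective c
  rw [CechPic.pullback_mk, CechPic.pullback_mk, CechPic.pullback_mk]
  refine CechPic.sound (UnitCocycle.equiv_of_eq _ _
    (fun x => f ⁻¹ᵁ (g ⁻¹ᵁ c.U (g.base (f.base x)))) (fun x => c.mem (g.base (f.base x)))
    (fun x => le_of_eq rfl) (fun x => le_rfl) fun x y V hx hy => ?_)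
  change (g.appLE _ _ _ ≫ f.appLE _ V _) (c.g _ _ _ _ _) = (f ≫ g).appLE _ V _ (c.g _ _ _ _ _)
  rw [Scheme.Hom.appLE_comp_appLE]
  rfl

/-- `ofMul (f^*[M ⊗ N]) = ofMul (f^*[M]) + ofMul (f^*[N])` for line bundles `M`, `N`. [cite: Hartshorne1977, II Ex. 6.11] -/
private theorem ofMul_pullback_detClass_tensorObj {X Y : Scheme.{0}} (f : Y ⟶ X) {M N : X.Modules}
    (hM : IsFiniteLocallyFree M) (hN : IsFiniteLocallyFree N) (hM₁ : HasRank M 1) (hN₁ : HasRank N 1)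
    (h : IsFiniteLocallyFree (tensorObj M N)) :
    Additive.ofMul (CechPic.pullback f (detClass h)) =
      Additive.ofMul (CechPic.pullback f (detClass hM)) + Additive.ofMul (CechPic.pullback f (detClass hN)) := by
  rw [detClass_tensorObj_of_hasRank_one hM₁ hN₁ hM hN h, MonoidHom.map_mul, ofMul_mul]

/-- **THE CLASS OF `π′^*𝒩₀` IN MONOMIALS** (`a, b` the two `A`-coordinates of `Z = (A × A) × Â`, `β′ = β·φ_Θ⁻¹`, `|Gᵢ| = n` odd):
`ofMul (π′^*[𝒩₀]) = m₁·n·(λ(a) + λ(a⁻¹)) + m₂·n·(λ(b) + λ(b⁻¹)) + (s·λ(β′) + (s+1)·λ(β′⁻¹)) + m₁·n·Λ(a, β′) + m₂·n·Λ(b, β′)` — by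
`πᵢ^*[isogenyNorm πᵢ Θ_sym] = [Θ_sym]^n` (odd `n`), `π′ ≫ κᵢ = (aᵢⁿ, β)` and `Λ(xⁿ, y) = n·Λ(x, y)`.
[cite: MumfordAV1970, §7 Thm. 4 (p. 72) and §23] [cite: Markman2025SecantWeil, §9.3 Remark 9.3.7 (p. 73)] -/
theorem ofMul_pullback_quotientSpanProjection_detClass_markmanDescendedKernel (hodd : Odd n) (hc₁ : Nat.card G₁ = n)
    (hc₂ : Nat.card G₂ = n) (s m₁ m₂ : ℕ) :
    haveI := isIntegral_pairDual A hΘ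
    Additive.ofMul (CechPic.pullback (quotientSpanProjection A hΘ hn G₁ G₂ hG₁ hG₂).left
        (detClass (isFiniteLocallyFree_markmanDescendedKernel A hΘ hK hn G₁ G₂ hG₁ hG₂ s m₁ m₂))) =
      m₁ • n • (AbelianVariety.lam Θ (cechCl ((A.X ⊗ A.X) ⊗ (A.dualOf Θ hΘ).X).left) (pr₁₂ A A (A.dualOf Θ hΘ) ≫ fst A.X A.X) +
          AbelianVariety.lam Θ (cechCl ((A.X ⊗ A.X) ⊗ (A.dualOf Θ hΘ).X).left) (pr₁₂ A A (A.dualOf Θ hΘ) ≫ fst A.X A.X)⁻¹) +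
        m₂ • n • (AbelianVariety.lam Θ (cechCl ((A.X ⊗ A.X) ⊗ (A.dualOf Θ hΘ).X).left) (pr₁₂ A A (A.dualOf Θ hΘ) ≫ snd A.X A.X) +
          AbelianVariety.lam Θ (cechCl ((A.X ⊗ A.X) ⊗ (A.dualOf Θ hΘ).X).left) (pr₁₂ A A (A.dualOf Θ hΘ) ≫ snd A.X A.X)⁻¹) +
        (s • AbelianVariety.lam Θ (cechCl ((A.X ⊗ A.X) ⊗ (A.dualOf Θ hΘ).X).left) (snd _ _ ≫ phiThetaInv A hΘ hK) +
          (s + 1) • AbelianVariety.lam Θ (cechCl ((A.X ⊗ A.X) ⊗ (A.dualOf Θ hΘ).X).left) (snd _ _ ≫ phiThetaInv A hΘ hK)⁻¹) +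
        m₁ • n • AbelianVariety.Lam Θ (cechCl ((A.X ⊗ A.X) ⊗ (A.dualOf Θ hΘ).X).left) (pr₁₂ A A (A.dualOf Θ hΘ) ≫ fst A.X A.X)
          (snd _ _ ≫ phiThetaInv A hΘ hK) +
        m₂ • n • AbelianVariety.Lam Θ (cechCl ((A.X ⊗ A.X) ⊗ (A.dualOf Θ hΘ).X).left) (pr₁₂ A A (A.dualOf Θ hΘ) ≫ snd A.X A.X)
          (snd _ _ ≫ phiThetaInv A hΘ hK) := by
  haveI := isIntegral_pairDual A hΘ
  letI := AbelianVariety.kerPointsTorsionQuotHomFintype A hn G₁ hG₁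
  letI := AbelianVariety.kerPointsTorsionQuotHomFintype A hn G₂ hG₂
  have hπ₁ := A.isIsogeny_torsionQuotHom hn G₁ hG₁
  have hπ₂ := A.isIsogeny_torsionQuotHom hn G₂ hG₂
  have hcard₁ : Fintype.card ↥(AbelianVariety.Hom.kerPoints (specOver ℂ ℂ) (A.torsionQuotHom hn G₁ hG₁)) = n := by
    rw [AbelianVariety.card_kerPoints_torsionQuotHom, hc₁]
  have hcard₂ : Fintype.card ↥(AbelianVariety.Hom.kerPoints (specOver ℂ ℂ) (A.torsionQuotHom hn G₂ hG₂)) = n := by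
    rw [AbelianVariety.card_kerPoints_torsionQuotHom, hc₂]
  have hodd₁ : Odd (Fintype.card ↥(AbelianVariety.Hom.kerPoints (specOver ℂ ℂ) (A.torsionQuotHom hn G₁ hG₁))) := by
    rw [hcard₁]; exact hodd
  have hodd₂ : Odd (Fintype.card ↥(AbelianVariety.Hom.kerPoints (specOver ℂ ℂ) (A.torsionQuotHom hn G₂ hG₂))) := by
    rw [hcard₂]; exact hodd
  have hS := isFiniteLocallyFree_symTheta A (Θ := Θ)
  have hSr := hasRank_symTheta A (Θ := Θ)
  have hN₁ := isFiniteLocallyFree_isogenyNorm (A.torsionQuotHom hn G₁ hG₁) hπ₁ (symTheta A Θ) hS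
  have hN₂ := isFiniteLocallyFree_isogenyNorm (A.torsionQuotHom hn G₂ hG₂) hπ₂ (symTheta A Θ) hS
  have hN₁r := hasRank_isogenyNorm (A.torsionQuotHom hn G₁ hG₁) hπ₁ (symTheta A Θ) hS
  have hN₂r := hasRank_isogenyNorm (A.torsionQuotHom hn G₂ hG₂) hπ₂ (symTheta A Θ) hS
  have hP := isFiniteLocallyFree_poincareSheaf A hΘ hK
  have hPr := hasRank_poincareSheaf A hΘ hK
  have hD := isFiniteLocallyFree_dualTwist A hΘ hK s
  have hDr := hasRank_dualTwist A hΘ hK s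
  -- the five factors of `𝒩₀`, their local freeness and ranks
  have h₁ := (isFiniteLocallyFree_tensorPow hN₁ m₁).pullback
    (pr₁₂ (A.torsionQuot hn G₁ hG₁) (A.torsionQuot hn G₂ hG₂) (A.dualOf Θ hΘ) ≫ fst _ _).left
  have h₂ := (isFiniteLocallyFree_tensorPow hN₂ m₂).pullback
    (pr₁₂ (A.torsionQuot hn G₁ hG₁) (A.torsionQuot hn G₂ hG₂) (A.dualOf Θ hΘ) ≫ snd _ _).left
  have h₃ := hD.pullback (snd ((A.torsionQuot hn G₁ hG₁).X ⊗ (A.torsionQuot hn G₂ hG₂).X) (A.dualOf Θ hΘ).X).left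
  have h₄ := (isFiniteLocallyFree_tensorPow hP m₁).pullback (kappa₁ A hΘ hn G₁ G₂ hG₁ hG₂).left
  have h₅ := (isFiniteLocallyFree_tensorPow hP m₂).pullback (kappa₂ A hΘ hn G₁ G₂ hG₁ hG₂).left
  have r₁ := hasRank_pullback (pr₁₂ (A.torsionQuot hn G₁ hG₁) (A.torsionQuot hn G₂ hG₂) (A.dualOf Θ hΘ) ≫ fst _ _).left
    (hasRank_tensorPow_one hN₁r m₁)
  have r₂ := hasRank_pullback (pr₁₂ (A.torsionQuot hn G₁ hG₁) (A.torsionQuot hn G₂ hG₂) (A.dualOf Θ hΘ) ≫ snd _ _).left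
    (hasRank_tensorPow_one hN₂r m₂)
  have r₃ := hasRank_pullback (snd ((A.torsionQuot hn G₁ hG₁).X ⊗ (A.torsionQuot hn G₂ hG₂).X) (A.dualOf Θ hΘ).X).left hDr
  have r₄ := hasRank_pullback (kappa₁ A hΘ hn G₁ G₂ hG₁ hG₂).left (hasRank_tensorPow_one hPr m₁)
  have r₅ := hasRank_pullback (kappa₂ A hΘ hn G₁ G₂ hG₁ hG₂).left (hasRank_tensorPow_one hPr m₂)
  have h₁₂ := isFiniteLocallyFree_tensorObj _ _ h₁ h₂
  have h₁₂₃ := isFiniteLocallyFree_tensorObj _ _ h₁₂ h₃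
  have h₁₂₃₄ := isFiniteLocallyFree_tensorObj _ _ h₁₂₃ h₄
  rw [ofMul_pullback_detClass_tensorObj _ h₁₂₃₄ h₅ (hasRank_tensorObj_one (hasRank_tensorObj_one (hasRank_tensorObj_one r₁ r₂) r₃) r₄) r₅,
    ofMul_pullback_detClass_tensorObj _ h₁₂₃ h₄ (hasRank_tensorObj_one (hasRank_tensorObj_one r₁ r₂) r₃) r₄,
    ofMul_pullback_detClass_tensorObj _ h₁₂ h₃ (hasRank_tensorObj_one r₁ r₂) r₃,
    ofMul_pullback_detClass_tensorObj _ h₁ h₂ r₁ r₂]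
  -- factor 1: `a^*π₁^*[N₁]^{m₁} = (a^*[Θ_sym])^{n m₁}`
  rw [detClass_pullback _ (isFiniteLocallyFree_tensorPow hN₁ m₁), ← cechPic_pullback_comp₄, ← Over.comp_left,
    quotientSpanProjection_comp_pr₁, Over.comp_left, cechPic_pullback_comp₄, detClass_tensorPow hN₁r hN₁, MonoidHom.map_pow,
    pullback_detClass_isogenyNorm_of_odd _ hπ₁ _ hS hodd₁, hcard₁, MonoidHom.map_pow, MonoidHom.map_pow, ofMul_pow, ofMul_pow,
    ofMul_pullback_detClass_symTheta]
  -- factor 2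
  rw [detClass_pullback _ (isFiniteLocallyFree_tensorPow hN₂ m₂), ← cechPic_pullback_comp₄, ← Over.comp_left,
    quotientSpanProjection_comp_pr₂, Over.comp_left, cechPic_pullback_comp₄, detClass_tensorPow hN₂r hN₂, MonoidHom.map_pow,
    pullback_detClass_isogenyNorm_of_odd _ hπ₂ _ hS hodd₂, hcard₂, MonoidHom.map_pow, MonoidHom.map_pow, ofMul_pow, ofMul_pow,
    ofMul_pullback_detClass_symTheta]
  -- factor 3: the `Â`-twist along `β`
  rw [detClass_pullback _ hD, ← cechPic_pullback_comp₄, ← Over.comp_left, quotientSpanProjection_comp_snd,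
    ofMul_pullback_detClass_dualTwist]
  -- factors 4, 5: `𝒫^{⊗mᵢ}` along `π′ ≫ κᵢ = (aᵢⁿ, β)`
  rw [detClass_pullback _ (isFiniteLocallyFree_tensorPow hP m₁), detClass_pullback _ (isFiniteLocallyFree_tensorPow hP m₂),
    ← cechPic_pullback_comp₄, ← cechPic_pullback_comp₄, ← Over.comp_left, ← Over.comp_left, detClass_tensorPow hPr hP,
    detClass_tensorPow hPr hP, MonoidHom.map_pow, MonoidHom.map_pow, ofMul_pow, ofMul_pow, pullback_detClass_poincareSheaf,
    pullback_detClass_poincareSheaf, ← Category.assoc (quotientSpanProjection A hΘ hn G₁ G₂ hG₁ hG₂ ≫ kappa₁ A hΘ hn G₁ G₂ hG₁ hG₂),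
    ← Category.assoc (quotientSpanProjection A hΘ hn G₁ G₂ hG₁ hG₂ ≫ kappa₂ A hΘ hn G₁ G₂ hG₁ hG₂),
    quotientSpanProjection_comp_kappa₁_fst, quotientSpanProjection_comp_kappa₁_snd, quotientSpanProjection_comp_kappa₂_fst,
    quotientSpanProjection_comp_kappa₂_snd,
    AbelianVariety.Lam_pow_left (cechCl_add _) (linEquiv_iff_cechCl_eq _) A.cubicalStructure_linEquiv_holds,
    AbelianVariety.Lam_pow_left (cechCl_add _) (linEquiv_iff_cechCl_eq _) A.cubicalStructure_linEquiv_holds]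

/-- **THE CLASS IDENTITY `π′^*[𝒩₀] = [𝒩] · g′^*[D′_s]`** in `Ȟ¹((A×A)×Â, 𝒪^×)`, for `2j + 1 = n = |G₁| = |G₂|`, `n m₁ = 2s + j + 1`,
`n m₂ + j = 2s`: both sides are `n m₁(λ(a)+λ(a⁻¹)) + n m₂(λ(b)+λ(b⁻¹)) + sλ(β′) + (s+1)λ(β′⁻¹) + n m₁Λ(a,β′) + n m₂Λ(b,β′)` — the
right side by F18a's expansion of `[𝒩]` and of `[D′_s]` along `g′ = (ab⁻¹, β·φ_Θ(ab))` (cross term `Λ(a,b)` vanishes exactly).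
[cite: Markman2025SecantWeil, §9.3 Lemma 9.3.5 and Remark 9.3.7 (pp. 71–73)] [cite: MumfordAV1970, §6 Cor. 3–4, §7 Thm. 4, §23] -/
theorem pullback_quotientSpanProjection_detClass_markmanDescendedKernel {s j m₁ m₂ : ℕ} (hj : 2 * j + 1 = n)
    (hm₁ : n * m₁ = 2 * s + j + 1) (hm₂ : n * m₂ + j = 2 * s) (hc₁ : Nat.card G₁ = n) (hc₂ : Nat.card G₂ = n) :
    CechPic.pullback (quotientSpanProjection A hΘ hn G₁ G₂ hG₁ hG₂).left
        (detClass (isFiniteLocallyFree_markmanDescendedKernel A hΘ hK hn G₁ G₂ hG₁ hG₂ s m₁ m₂)) =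
      detClass (isFiniteLocallyFree_markmanTwistedKernel A hΘ hK) *
        CechPic.pullback (kernelSpanMap A hΘ).left (detClass (isFiniteLocallyFree_descentTwist A hΘ hK s j)) := by
  haveI := isIntegral_pairDual A hΘ
  have hodd : Odd n := ⟨j, by omega⟩
  have hadd := cechCl_add ((A.X ⊗ A.X) ⊗ (A.dualOf Θ hΘ).X).left
  have heq := linEquiv_iff_cechCl_eq ((A.X ⊗ A.X) ⊗ (A.dualOf Θ hΘ).X).left
  have hcube := A.cubicalStructure_linEquiv_holds
  have hml : ∀ x y z : (A.X ⊗ A.X) ⊗ (A.dualOf Θ hΘ).X ⟶ A.X,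
      AbelianVariety.Lam Θ (cechCl ((A.X ⊗ A.X) ⊗ (A.dualOf Θ hΘ).X).left) (x * y) z =
        AbelianVariety.Lam Θ (cechCl ((A.X ⊗ A.X) ⊗ (A.dualOf Θ hΘ).X).left) x z +
          AbelianVariety.Lam Θ (cechCl ((A.X ⊗ A.X) ⊗ (A.dualOf Θ hΘ).X).left) y z :=
    fun x y z => AbelianVariety.Lam_mul_left hadd heq hcube x y z
  have hmr : ∀ x y z : (A.X ⊗ A.X) ⊗ (A.dualOf Θ hΘ).X ⟶ A.X,
      AbelianVariety.Lam Θ (cechCl ((A.X ⊗ A.X) ⊗ (A.dualOf Θ hΘ).X).left) x (y * z) =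
        AbelianVariety.Lam Θ (cechCl ((A.X ⊗ A.X) ⊗ (A.dualOf Θ hΘ).X).left) x y +
          AbelianVariety.Lam Θ (cechCl ((A.X ⊗ A.X) ⊗ (A.dualOf Θ hΘ).X).left) x z :=
    fun x y z => AbelianVariety.Lam_mul_right hadd heq hcube x y z
  have hinv := Lam_inv_right A (Θ := Θ) (T := (A.X ⊗ A.X) ⊗ (A.dualOf Θ hΘ).X)
  have hinvl := Lam_inv_left A (Θ := Θ) (T := (A.X ⊗ A.X) ⊗ (A.dualOf Θ hΘ).X)
  have hle := lam_mul_eq A (Θ := Θ) (T := (A.X ⊗ A.X) ⊗ (A.dualOf Θ hΘ).X)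
  have hself := Lam_self A (Θ := Θ) (T := (A.X ⊗ A.X) ⊗ (A.dualOf Θ hΘ).X)
  -- the exponent arithmetic, as rewriting rules on the additive class group
  have key₁ : ∀ X : Additive (CechPic ((A.X ⊗ A.X) ⊗ (A.dualOf Θ hΘ).X).left), m₁ • n • X = s • X + s • X + j • X + X := by
    intro X
    rw [smul_smul, mul_comm, hm₁, add_nsmul, add_nsmul, one_nsmul, mul_nsmul', two_nsmul]
  have key₂ : ∀ X : Additive (CechPic ((A.X ⊗ A.X) ⊗ (A.dualOf Θ hΘ).X).left), m₂ • n • X = s • X + s • X - j • X := by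
    intro X
    rw [eq_sub_iff_add_eq, smul_smul, mul_comm, ← add_nsmul, hm₂, mul_nsmul', two_nsmul]
  -- the class of `𝒩` itself (`g = 𝟙`)
  have h0 := ofMul_pullback_detClass_markmanTwistedKernel A hΘ hK (𝟙 ((A.X ⊗ A.X) ⊗ (A.dualOf Θ hΘ).X))
  rw [Over.id_left, CechPic.pullback_id_apply] at h0
  simp only [Category.id_comp] at h0
  apply Additive.ofMul.injective
  rw [ofMul_pullback_quotientSpanProjection_detClass_markmanDescendedKernel A hΘ hK hn G₁ G₂ hG₁ hG₂ hodd hc₁ hc₂, ofMul_mul, h0,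
    ofMul_pullback_detClass_descentTwist, kernelSpanMap_comp_fst, ← Category.assoc (kernelSpanMap A hΘ), kernelSpanMap_comp_snd,
    MonObj.mul_comp, Category.assoc, phiTheta_comp_phiThetaInv, Category.comp_id]
  simp only [mul_inv_rev, inv_inv, hle, hml, hmr, hinv, hinvl, hself, smul_add, smul_neg, add_nsmul, one_nsmul, neg_neg,
    key₁, key₂]
  simp only [AbelianVariety.Lam_comm (pr₁₂ A A (A.dualOf Θ hΘ) ≫ snd A.X A.X) (pr₁₂ A A (A.dualOf Θ hΘ) ≫ fst A.X A.X),
    AbelianVariety.Lam_comm (snd _ _ ≫ phiThetaInv A hΘ hK) (pr₁₂ A A (A.dualOf Θ hΘ) ≫ fst A.X A.X),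
    AbelianVariety.Lam_comm (snd _ _ ≫ phiThetaInv A hΘ hK) (pr₁₂ A A (A.dualOf Θ hΘ) ≫ snd A.X A.X)]
  abel

/-- **KERNEL DESCENT: `π′^*𝒩₀ ≅ 𝒩 ⊗ g′^*D′_s`** — the twisted span kernel of Markman's `Φ̃`, multiplied by `g′^*D′_s`, is the
pull-back of the EXPLICIT line bundle `𝒩₀` on `(A/G₁ × A/G₂) × Â` along `π′ = (π₁ × π₂) × 1`, for any finite subgroups
`G₁, G₂ ≤ A[n](ℂ)` of odd order `n = 2j+1` and exponents with `n m₁ = 2s + j + 1`, `n m₂ + j = 2s` (objectwise, rank-one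
classification; no linearisation, no cocycle). Print's Remark 9.3.7 descent of `𝒢 ⊗ D^a` read on the kernel.
[cite: Markman2025SecantWeil, §9.3 Lemma 9.3.5 and Remark 9.3.7 (pp. 71–73)] [cite: MumfordAV1970, §7 Thm. 4 (p. 72) and §23] -/
theorem nonempty_pullback_markmanDescendedKernel_iso {s j m₁ m₂ : ℕ} (hj : 2 * j + 1 = n) (hm₁ : n * m₁ = 2 * s + j + 1)
    (hm₂ : n * m₂ + j = 2 * s) (hc₁ : Nat.card G₁ = n) (hc₂ : Nat.card G₂ = n) :
    Nonempty ((Scheme.Modules.pullback (quotientSpanProjection A hΘ hn G₁ G₂ hG₁ hG₂).left).obj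
        (markmanDescendedKernel A hΘ hK hn G₁ G₂ hG₁ hG₂ s m₁ m₂) ≅
      tensorObj (markmanTwistedKernel A hΘ hK)
        ((Scheme.Modules.pullback (kernelSpanMap A hΘ).left).obj (descentTwist A hΘ hK s j))) := by
  have hN := isFiniteLocallyFree_markmanTwistedKernel A hΘ hK
  have hN₁ := hasRank_markmanTwistedKernel A hΘ hK
  have hD := isFiniteLocallyFree_descentTwist A hΘ hK s j
  have hD₁ := hasRank_descentTwist A hΘ hK s j
  have h₀ := isFiniteLocallyFree_markmanDescendedKernel A hΘ hK hn G₁ G₂ hG₁ hG₂ s m₁ m₂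
  have h₀₁ := hasRank_markmanDescendedKernel A hΘ hK hn G₁ G₂ hG₁ hG₂ s m₁ m₂
  refine (nonempty_iso_iff_detClass_eq (hasRank_pullback (quotientSpanProjection A hΘ hn G₁ G₂ hG₁ hG₂).left h₀₁)
    (hasRank_tensorObj_one hN₁ (hasRank_pullback (kernelSpanMap A hΘ).left hD₁))
    (h₀.pullback (quotientSpanProjection A hΘ hn G₁ G₂ hG₁ hG₂).left)
    (isFiniteLocallyFree_tensorObj _ _ hN (hD.pullback (kernelSpanMap A hΘ).left))).2 ?_
  have e₁ := detClass_pullback (quotientSpanProjection A hΘ hn G₁ G₂ hG₁ hG₂).left h₀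
  have e₂ := detClass_tensorObj_of_hasRank_one hN₁ (hasRank_pullback (kernelSpanMap A hΘ).left hD₁) hN
    (hD.pullback (kernelSpanMap A hΘ).left)
  have e₃ := detClass_pullback (kernelSpanMap A hΘ).left hD
  rw [e₁, pullback_quotientSpanProjection_detClass_markmanDescendedKernel A hΘ hK hn G₁ G₂ hG₁ hG₂ hj hm₁ hm₂ hc₁ hc₂, e₂, e₃]

omit hΘ in
/-- **The exponents exist for every odd `n`:** `j = (n−1)/2`; `s = j/2`, `(m₁, m₂) = (1, 0)` for `j` even and `s = (3j+1)/2`,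
`(m₁, m₂) = (2, 1)` for `j` odd. [cite: Markman2025SecantWeil, §9.3 Lemma 9.3.5 (p. 71: d even, n = d + 1 odd)] -/
theorem exists_descent_exponents (hodd : Odd n) :
    ∃ s j m₁ m₂ : ℕ, 2 * j + 1 = n ∧ n * m₁ = 2 * s + j + 1 ∧ n * m₂ + j = 2 * s := by
  obtain ⟨j, rfl⟩ := hodd
  rcases Nat.even_or_odd j with ⟨t, rfl⟩ | ⟨t, rfl⟩
  · exact ⟨t, t + t, 1, 0, by ring, by ring, by ring⟩
  · exact ⟨3 * t + 2, 2 * t + 1, 2, 1, by ring, by ring, by ring⟩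

end Identity

end Literature.AlgebraicGeometry.AbelianVarieties

end
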